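import Summits.ValiantsHypothesis.ValiantsHypothesis.Theorems.FifoMatchingNNDivisionHardLocalizationSieve

/-!
# FifoMatching · NNDivisionHard — localization, part 5: §10 the FULL SWITCHING CLOSURE `SwStar` / `OrbStar` (decided; glue)

Theorems-grade port (bytes staged by val-idea-43 g5 for a port hand) of §10 of the crux workfile `Cruxes/NNDivisionHard/Localization43.lean`
rev 6 @f9e951ebdad4 (val-idea-43 g5; crux `stmt-ValiantsHypothesis-21181` `FifoMatching.NNDivisionHard`; parts 1–4 = rev 5 @6763e14e8ba5, crit-9 g2
V#47 / V#53 / V#59 KEEP) — statements and proofs VERBATIM, namespace `…Theorems.FifoMatching.Localization`.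

Part 5: `swList` (composite switching), ★ `hasEFOfSize_pair_swList` (transport), `SwStar` / ★★ `decided_swStar` / `decidedB_swStar`,
`OrbStar := Loc (SwStar ·)` ⊇ `Orb` ⊇ `Loc` (`loc_le_orb`, `orb_le_orbStar`), ★★ `decided_orbStar`, `residualLaw_anti` /
`residualLaw_orb_of_loc` / `residualLaw_orbStar_of_orb` (the residual laws get weaker), ★★★ `corVirtualHard_of_residualLawOrbStar`
(for the pen's rev 20: the residual law on budgeted families outside the cone on every `⌊√h⌋` minor after every composite switching
suffices), `orbStar_colSep_decided`.
-/

set_option linter.unusedVariables false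
set_option linter.unusedSectionVars false
set_option linter.dupNamespace false

namespace Summit.ValiantsHypothesis.ValiantsHypothesis.Theorems.FifoMatching.Localization

open Matrix Finset
open scoped Pointwise
open Literature.Barriers.PneNP (HasEFOfSize)
open Literature.Combinatorics.Optimization (corPolytopeGraph corVec)

/-! ## §10 (REV 6, 2026-08-28T23:45Z — pen val-idea-42 g2's rev 19/20 question (Q)) THE FULL SWITCHING CLOSURE `SwStar` / `OrbStar`

`Orb X = Loc (X ∨ Sw X)` (§7) is ONE orbit step: on some `⌊√h⌋`-minor, as read or after ONE switching.  Here the closure under ANY finite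
composite of switchings `swList L = swLin a₁ ∘ ⋯ ∘ swLin a_k` (on the minor): `SwStar X ∋ q :⟺ ∃ L, swList L ∘ q ∈ X`,
`OrbStar X := Loc (SwStar X) ⊇ Orb X ⊇ Loc X ⊇ X`.  ★★ `decided_swStar`, `decided_orbStar` (same threshold / exchange `c ↦ 2c` as `Loc`),
★★★ glue `corVirtualHard_of_residualLawOrbStar : Decided X → ResidualLaw (OrbStar X) → CorVirtualHard` — the weakest residual law of the
three (`ResidualLaw (Loc X) → ResidualLaw (Orb X) → ResidualLaw (OrbStar X)` are NOT implications; the residual laws get WEAKER: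
`residualLaw_orbStar_of_orb`, `residualLaw_orb_of_loc`).  ENEMY SPEC for `C♭_orb⋆`: outside `X` on every `⌊√h⌋` principal minor after EVERY
composite switching `x ↦ x ⊕ 𝟙_S` (`S ⊆` the minor).  The order «switch the whole family, then delete» gives the same class (a switching at
`a ∉ range ι` is invisible on the minor, at `a = ι a'` it is `swLin a'` on the minor) — not needed below, not typed. -/

/-- the composite switching along a list of vertices (`[] ↦ id`, `a :: L ↦ swLin a ∘ swList L`). -/
def swList {h : ℕ} : List (Fin h) → ((Fin h × Fin h → ℝ) →ₗ[ℝ] (Fin h × Fin h → ℝ))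
  | [] => LinearMap.id
  | a :: L => (swLin a).comp (swList L)

/-- the empty composite switching reads the family as is. -/
@[simp] theorem swList_nil_comp {h K : ℕ} (q : Fam h K) : (⇑(swList ([] : List (Fin h))) ∘ q) = q := by
  funext j; rfl

/-- a composite switching `a :: L` reads the family through `swLin a` after `swList L`. -/
@[simp] theorem swList_cons_comp {h K : ℕ} (a : Fin h) (L : List (Fin h)) (q : Fam h K) :
    (⇑(swList (a :: L)) ∘ q) = ⇑(swLin a) ∘ (⇑(swList L) ∘ q) := by
  funext j; rfl

/-- composite switchings compose along list append. -/
theorem swList_append_comp {h K : ℕ} (L₁ L₂ : List (Fin h)) (q : Fam h K) :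
    (⇑(swList (L₁ ++ L₂)) ∘ q) = ⇑(swList L₁) ∘ (⇑(swList L₂) ∘ q) := by
  induction L₁ with
  | nil => simp
  | cons a L ih => rw [List.cons_append, swList_cons_comp, swList_cons_comp, ih]

/-- ★ TRANSPORT along a composite switching: an EF of the pair is an EF of the switched pair (same size). -/
theorem hasEFOfSize_pair_swList {h K : ℕ} (L : List (Fin h)) (q : Fam h K) {r : ℕ}
    (hEF : HasEFOfSize (corPolytopeGraph (⊤ : SimpleGraph (Fin h)) + convexHull ℝ (Set.range q)) r) :
    HasEFOfSize (corPolytopeGraph (⊤ : SimpleGraph (Fin h)) + convexHull ℝ (Set.range (⇑(swList L) ∘ q))) r := by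
  induction L with
  | nil => rw [swList_nil_comp]; exact hEF
  | cons a L ih => rw [swList_cons_comp]; exact hasEFOfSize_pair_sw a _ ih

/-- transport of an EF of the passenger hull along a composite switching (same size). -/
theorem hasEFOfSize_hull_swList {h K : ℕ} (L : List (Fin h)) (q : Fam h K) {r : ℕ}
    (hEF : HasEFOfSize (convexHull ℝ (Set.range q)) r) :
    HasEFOfSize (convexHull ℝ (Set.range (⇑(swList L) ∘ q))) r := by
  induction L with
  | nil => rw [swList_nil_comp]; exact hEF
  | cons a L ih => rw [swList_cons_comp]; exact hasEFOfSize_hull_sw a _ ih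

/-- **`SwStar X`** — the SWITCHING CLOSURE of the class: `q` read through SOME composite switching lies in `X`. -/
def SwStar (X : PClass) : PClass := fun h K q => ∃ L : List (Fin h), X h K (⇑(swList L) ∘ q)

/-- `X ≤ SwStar X` (empty switching). -/
theorem le_swStar {X : PClass} {h K : ℕ} {q : Fam h K} (hq : X h K q) : SwStar X h K q :=
  ⟨[], by rw [swList_nil_comp]; exact hq⟩

/-- `Sw X ≤ SwStar X` (one switching). -/
theorem sw_le_swStar {X : PClass} {h K : ℕ} {q : Fam h K} (hq : Sw X h K q) : SwStar X h K q := by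
  obtain ⟨a, ha⟩ := hq
  exact ⟨[a], by rw [swList_cons_comp, swList_nil_comp]; exact ha⟩

/-- the closure is idempotent: `SwStar (SwStar X) ≤ SwStar X` (lists append). -/
theorem swStar_swStar_le {X : PClass} {h K : ℕ} {q : Fam h K} (hq : SwStar (SwStar X) h K q) : SwStar X h K q := by
  obtain ⟨L₁, L₂, hx⟩ := hq
  exact ⟨L₂ ++ L₁, by rw [swList_append_comp]; exact hx⟩

/-- ★★ **SWITCHING-CLOSURE THEOREM.** `Decided X → Decided (SwStar X)`, same threshold. -/
theorem decided_swStar {X : PClass} (hX : Decided X) : Decided (SwStar X) := by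
  intro c
  obtain ⟨h₀, H⟩ := hX c
  refine ⟨h₀, fun h hh K q r hq hEF => ?_⟩
  obtain ⟨L, hL⟩ := hq
  exact H h hh K _ r hL (hasEFOfSize_pair_swList L q hEF)

/-- budgeted version. -/
theorem decidedB_swStar {X : PClass} (hX : DecidedB X) : DecidedB (SwStar X) := by
  intro c
  obtain ⟨h₀, H⟩ := hX c
  refine ⟨h₀, fun h hh K q r hq hB hEF => ?_⟩
  obtain ⟨L, hL⟩ := hq
  exact H h hh K _ r hL (hasEFOfSize_hull_swList L q hB) (hasEFOfSize_pair_swList L q hEF)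

/-- **`OrbStar X := Loc (SwStar X)`** — on SOME `⌊√h⌋`-deletion minor, after SOME composite switching of the minor, `q` lies in `X`. -/
def OrbStar (X : PClass) : PClass := Loc (SwStar X)

/-- `Loc X ≤ Orb X`. -/
theorem loc_le_orb {X : PClass} {h K : ℕ} {q : Fam h K} (hq : Loc X h K q) : Orb X h K q :=
  locAt_mono Nat.sqrt (fun _ _ _ hx => Or.inl hx) hq

/-- `Orb X ≤ OrbStar X`. -/
theorem orb_le_orbStar {X : PClass} {h K : ℕ} {q : Fam h K} (hq : Orb X h K q) : OrbStar X h K q := by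
  unfold Orb at hq
  exact locAt_mono Nat.sqrt (X := fun h K q => X h K q ∨ Sw X h K q) (Y := SwStar X)
    (fun _ _ _ hx => hx.elim le_swStar sw_le_swStar) hq

/-- `X ≤ OrbStar X`. -/
theorem le_orbStar {X : PClass} {h K : ℕ} {q : Fam h K} (hq : X h K q) : OrbStar X h K q :=
  orb_le_orbStar (le_orb hq)

/-- ★★ `Decided X → Decided (OrbStar X)` (the localization exchange `c ↦ 2c` of §3, once). -/
theorem decided_orbStar {X : PClass} (hX : Decided X) : Decided (OrbStar X) :=
  decided_loc (decided_swStar hX)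

/-- the three residual laws, weakest last: `ResidualLaw (Loc X) → ResidualLaw (Orb X)` … -/
theorem residualLaw_anti {X Y : PClass} (hXY : ∀ h K (q : Fam h K), X h K q → Y h K q) (hX : ResidualLaw X) :
    ResidualLaw Y := by
  intro c
  obtain ⟨h₀, H⟩ := hX c
  exact ⟨h₀, fun h hh K q r hq hB hEF => H h hh K q r (fun hx => hq (hXY h K q hx)) hB hEF⟩

/-- `ResidualLaw (Loc X) → ResidualLaw (Orb X)`. -/
theorem residualLaw_orb_of_loc {X : PClass} (hR : ResidualLaw (Loc X)) : ResidualLaw (Orb X) :=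
  residualLaw_anti (fun _ _ _ => loc_le_orb) hR

/-- `ResidualLaw (Orb X) → ResidualLaw (OrbStar X)`. -/
theorem residualLaw_orbStar_of_orb {X : PClass} (hR : ResidualLaw (Orb X)) : ResidualLaw (OrbStar X) :=
  residualLaw_anti (fun _ _ _ => orb_le_orbStar) hR

/-- ★★★ **GLUE (switching-closure form)** — for the pen's rev 20: with `X := Cone θ τ` (the fifteen c-free decided classes) it suffices to prove
the residual law on budgeted families that are OUTSIDE `X` ON EVERY `⌊√h⌋` DELETION MINOR AFTER EVERY COMPOSITE SWITCHING. -/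
theorem corVirtualHard_of_residualLawOrbStar {X : PClass} (hX : Decided X) (hR : ResidualLaw (OrbStar X)) : CorVirtualHard :=
  corVirtualHard_of_residualLaw (decided_orbStar hX) hR

/-- the pair sieve survives the closure: `OrbStar ColSep` is decided (so a `C♭_orb⋆` enemy has, on every `√h` minor and after every composite
switching, for every column two distinct vertices agreeing on it). -/
theorem orbStar_colSep_decided : Decided (OrbStar ColSep) := decided_orbStar colSep_decided

end Summit.ValiantsHypothesis.ValiantsHypothesis.Theorems.FifoMatching.Localization
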